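import Mathlib
import Summits.QuantumAdvantage.QuantumAdvantage.Theorems.MobiusLadderDigitPolyUniformityShiftInvariant
import Summits.QuantumAdvantage.QuantumAdvantage.Theorems.MobiusLadderDigitPolyUniformitySymmetricShift

/-!
# Crux `DigitPolyUniformity` (stmt-QuantumAdvantage-1392), line `Sketch` (LAR composition):
# sliding-window digital forms of ANY window are shift-invariant (uniform `1/3` bound)

Stub Z3 of line Sketch/LAR of crux stmt-QuantumAdvantage-1392
(`Summit.QuantumAdvantage.QuantumAdvantage.Theses.MobiusLadder.DigitPolyUniformity`). The landed stub X9
(`liouville_corr_le_of_shiftInvariant`, `Theorems/MobiusLadderDigitPolyUniformityShiftInvariant`) bounds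
the correlation of `λ` with every SHIFT-INVARIANT digital phase `χ_P(N) = (−1)^{P(bits N)}`
(`P(bits 2N) = P(bits N)` whenever `2N < 2ⁿ`) by `1/3`: `3·|Σ_{N<2ⁿ} λ χ_P| ≤ 2ⁿ + 1`. This file
supplies the SLIDING-WINDOW class. Fix a window length `L` and a local rule `q : {0,1}^L → 𝔽₂` with
`q(0…0) = 0`, and put

  `F_q(N) = Σ_{j < n + L} q(window_j(N))`,  `window_j(N) : t ↦ bit_{j + t + 1 − L}(N)` (`t < L`),

the sum of `q` over ALL length-`L` windows of the digit string of `N < 2ⁿ`, zero-padded on both sides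
(the window at offset `j` reads the digit positions `j + 1 − L, …, j`; negative positions read `0`).
Examples: the Rudin–Shapiro phase `Σ_i x_i x_{i+1}` (`L = 2`, `q(y) = y_0 y_1`) and every block-additive
sliding form, for ANY window length `L = L(n)`. CLAIM: `F_q(2N) = F_q(N)` for `2N < 2ⁿ`, so every `P`
whose cube values are `F_q` is shift-invariant and X9 applies (`liouville_corr_le_of_slidingWindow`).

Proof of the claim (pure bit arithmetic): `window_{j+1}(2N) = window_j(N)` for every `j`
(`bit_{p}(2N) = bit_{p−1}(N)` for `p ≥ 1` and `bit_0(2N) = 0`; `SlidingWindow.window_succ_two_mul`);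
the first window of `2N` reads only position `0` of `2N`, so it is all-zero
(`SlidingWindow.window_zero_two_mul`), and the last window of `N` reads positions `≥ n` of `N < 2ⁿ`,
so it is all-zero too (`SlidingWindow.window_last`). Reindexing (`Finset.sum_range_succ'` on the
`2N`-side, `Finset.sum_range_succ` on the `N`-side) and `q(0…0) = 0` for the two boundary windows give
`F_q(2N) = F_q(N)`. No named facts; Mathlib and the tree's `SymmetricShift.testBit_two_mul_succ`,
`SymmetricShift.testBit_two_mul_zero` (`Theorems/MobiusLadderDigitPolyUniformitySymmetricShift`) only.
-/

namespace Summit.QuantumAdvantage.DigitPolyUniformity.SketchLAR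

open Filter Finset

namespace SlidingWindow

/-- **Interior windows shift by one under doubling.** Entry `t` of the window of `2N` at offset
`j + 1` (digit position `j + t + 2 − L` of `2N`, or `0` if that position is negative) is entry `t` of
the window of `N` at offset `j` (digit position `j + t + 1 − L` of `N`, or `0`): digit `p + 1` of `2N`
is digit `p` of `N`, and digit `0` of `2N` vanishes (the case `L = j + t + 2`). [folklore] -/
theorem window_succ_two_mul (L j N : ℕ) (t : Fin L) :
    (if L ≤ j + 1 + (t : ℕ) + 1 then Nat.testBit (2 * N) (j + 1 + (t : ℕ) + 1 - L) else false) =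
      (if L ≤ j + (t : ℕ) + 1 then Nat.testBit N (j + (t : ℕ) + 1 - L) else false) := by
  by_cases h1 : L ≤ j + (t : ℕ) + 1
  · rw [if_pos h1, if_pos (by omega),
      show j + 1 + (t : ℕ) + 1 - L = j + (t : ℕ) + 1 - L + 1 by omega,
      SymmetricShift.testBit_two_mul_succ]
  · rw [if_neg h1]
    by_cases h2 : L ≤ j + 1 + (t : ℕ) + 1
    · rw [if_pos h2, show j + 1 + (t : ℕ) + 1 - L = 0 by omega, SymmetricShift.testBit_two_mul_zero]
    · rw [if_neg h2]

/-- **The first window of `2N` is all-zero.** The window of `2N` at offset `0` reads digit positions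
`t + 1 − L ≤ 0` (`t < L`), i.e. only position `0` of `2N` (for `t = L − 1`), which vanishes; all other
entries are padding zeros. [folklore] -/
theorem window_zero_two_mul (L N : ℕ) (t : Fin L) :
    (if L ≤ 0 + (t : ℕ) + 1 then Nat.testBit (2 * N) (0 + (t : ℕ) + 1 - L) else false) = false := by
  rw [ite_eq_right_iff]
  intro h
  rw [show 0 + (t : ℕ) + 1 - L = 0 by omega, SymmetricShift.testBit_two_mul_zero]

/-- **The last window of `N < 2ⁿ` is all-zero.** With `n + L = m + 1`, the window of `N` at the last
offset `m = n + L − 1` reads digit positions `m + t + 1 − L = n + t ≥ n` of `N < 2ⁿ ≤ 2^{n+t}`, which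
all vanish (`Nat.testBit_lt_two_pow`). [folklore] -/
theorem window_last {n L m N : ℕ} (hm : n + L = m + 1) (hN : N < 2 ^ n) (t : Fin L) :
    (if L ≤ m + (t : ℕ) + 1 then Nat.testBit N (m + (t : ℕ) + 1 - L) else false) = false := by
  rw [ite_eq_right_iff]
  intro _
  exact Nat.testBit_lt_two_pow
    (lt_of_lt_of_le hN (Nat.pow_le_pow_right (by norm_num) (by omega)))

/-- **Sliding-window forms are shift-invariant.** For `2N < 2ⁿ` and any rule `q` with `q(0…0) = 0`,
`Σ_{j<n+L} q(window_j(2N)) = Σ_{j<n+L} q(window_j(N))`: split off the first window of `2N`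
(`Finset.sum_range_succ'`) and the last window of `N` (`Finset.sum_range_succ`), both all-zero
(`window_zero_two_mul`, `window_last`) hence of `q`-value `q(0…0) = 0`, and match the remaining
`n + L − 1` windows by the unit shift (`window_succ_two_mul`). For `n + L = 0` both sums are empty.
[folklore] -/
theorem sum_window_two_mul {n L : ℕ} (q : (Fin L → Bool) → ZMod 2) (hq : q (fun _ => false) = 0)
    (N : ℕ) (hN : 2 * N < 2 ^ n) :
    ∑ j ∈ Finset.range (n + L),
        q (fun t : Fin L => if L ≤ j + t + 1 then Nat.testBit (2 * N) (j + t + 1 - L) else false) =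
      ∑ j ∈ Finset.range (n + L),
        q (fun t : Fin L => if L ≤ j + t + 1 then Nat.testBit N (j + t + 1 - L) else false) := by
  have hN' : N < 2 ^ n := by omega
  rcases (n + L).eq_zero_or_pos with h0 | hpos
  · rw [h0, sum_range_zero, sum_range_zero]
  · obtain ⟨m, hm⟩ : ∃ m, n + L = m + 1 := ⟨n + L - 1, by omega⟩
    rw [hm, sum_range_succ', sum_range_succ]
    have e1 : q (fun t : Fin L =>
        if L ≤ 0 + (t : ℕ) + 1 then Nat.testBit (2 * N) (0 + (t : ℕ) + 1 - L) else false) = 0 :=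
      (congrArg q (funext fun t => window_zero_two_mul L N t)).trans hq
    have e2 : q (fun t : Fin L =>
        if L ≤ m + (t : ℕ) + 1 then Nat.testBit N (m + (t : ℕ) + 1 - L) else false) = 0 :=
      (congrArg q (funext fun t => window_last hm hN' t)).trans hq
    rw [e1, e2]
    exact congrArg (· + (0 : ZMod 2))
      (sum_congr rfl fun j _ => congrArg q (funext fun t => window_succ_two_mul L j N t))

end SlidingWindow

/-- **Stub Z3 (sliding-window forms are shift-invariant; uniform `1/3` bound for every window).** Fix a
local rule `q : {0,1}^L → 𝔽₂` with `q(0) = 0` and let `F_q(N) = Σ_j q(bits_{j+1−L..j}(N))` be the sum of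
`q` over ALL length-`L` windows of the digit string of `N`, zero-padded on both sides (`j < n + L`; the
window at offset `j` reads positions `j + 1 − L, …, j`, digits at negative positions are `0`). Every `P`
whose cube values are `F_q` — Rudin–Shapiro `Σ x_i x_{i+1}` (`q = y_0 y_1`) and all block-additive
sliding forms, for ANY window length `L = L(n)` — satisfies `3·|Σ_{N<2ⁿ} λ χ_P| ≤ 2ⁿ + 1`,
unconditionally: the windows of `2N` are the windows of `N` shifted by one (`F_q(2N) = F_q(N)` for
`2N < 2ⁿ`, using `q(0) = 0` for the two boundary windows; `SlidingWindow.sum_window_two_mul`), so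
`liouville_corr_le_of_shiftInvariant` applies. [folklore] -/
theorem liouville_corr_le_of_slidingWindow {n L : ℕ} (q : (Fin L → Bool) → ZMod 2)
    (hq : q (fun _ => false) = 0) (P : MvPolynomial (Fin n) (ZMod 2))
    (hP : ∀ N : ℕ, N < 2 ^ n →
      MvPolynomial.eval (fun i : Fin n => if Nat.testBit N i then (1 : ZMod 2) else 0) P =
        ∑ j ∈ Finset.range (n + L),
          q (fun t : Fin L => if L ≤ j + t + 1 then Nat.testBit N (j + t + 1 - L) else false)) :
    3 * |∑ N ∈ Finset.range (2 ^ n), ((ArithmeticFunction.liouville N : ℤ) : ℝ) *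
        (if MvPolynomial.eval (fun i : Fin n => if Nat.testBit N i then (1 : ZMod 2) else 0) P = 1
          then (-1 : ℝ) else 1)| ≤ (2 : ℝ) ^ n + 1 := by
  refine liouville_corr_le_of_shiftInvariant P fun N hN => ?_
  rw [hP (2 * N) hN, hP N (by omega)]
  exact SlidingWindow.sum_window_two_mul q hq N hN

end Summit.QuantumAdvantage.DigitPolyUniformity.SketchLAR
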